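import Summits.Parity.GeneralizedHardyLittlewood.Theorems.PrimeLevelFamEdgeMomentsBeyondDiagonalDiagDecorTools
import Summits.Parity.GeneralizedHardyLittlewood.Theorems.BeyondDiagonalBeatsQuarter.KernelFormXSqLocal
import HarnessLib

/-!
# Route `PrimeLevelFamEdge`, crux K_A `MomentsBeyondDiagonal` (stmt-Parity-20007), line «petersson_layers» v4, stub `stub_diag`:
# **removing an additive prime decoration from a Selberg-coordinate sum: a prime sum of the same sums at `y/p`, modulus `np`**

Census R3(ii), analytic half (reduction (iii) of the roadmap): the log-decorated Selberg coordinates carry, on squarefree `k`,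
the additive prime sums `P_j(k) = Σ_{p∣k}(log p)^j` (`…DiagDecorMult`, `…DiagDecorTau2`). With the Selberg weights
`a_n(k) = copTauW n k = τ(k)W(k)[(k,n)=1]` of the `X²` chain:

* `copTauW_prime_mul` — `a_n(pk′) = a_n(p)·a_{np}(k′)` for a prime `p` and every `k′`
  (`a_n(p) = −2/(p+1)·[p∤n]`; both sides vanish when `p ∣ k′` since `W(p²·) = 0`);
* `sum_copTauW_mul_mul_sum_primeFactors_eq` — **`Σ_{k≤N} a_n(k)·G(k)·Σ_{p∣k} g(p) =
  Σ_{p≤N prime} g(p)·a_n(p)·Σ_{k′≤N/p} a_{np}(k′)·G(pk′)`**: a decorated Selberg sum is a PRIME SUM of undecorated Selberg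
  sums at `y/p` with modulus `np` — the structure already evaluated by `…DiagPrimeCoupling` / `…DiagPrimeSum`.

Def-free; theorems only. Helper `--supports stmt-Parity-20007`; closes nothing; K_A, K_B and the Parity summit are NOT
proved; nothing about Landau–Siegel zeros.

## References
* E. Kowalski, P. Michel, J. VanderKam, J. reine angew. Math. 526 (2000), (23)–(28) pp. 13–15.
  [cite: KowalskiMichelVanderKam2000, (23)–(28) — derivation (bookkeeping of log-decorations)]
-/

noncomputable section

open Finset ArithmeticFunction

namespace Summit.Parity.GeneralizedHardyLittlewood.Theorems.MomentsBeyondDiagonal.DiagLines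

open Literature.NumberTheory.LFunctions.KMV2000
open Summit.Parity.GeneralizedHardyLittlewood.Theorems.BeyondDiagonalBeatsQuarter.KernelFormXSq
  (copTauW copTauW_apply copTauW_apply_prime isMultiplicative_copTauW W_eq_zero_of_not_squarefree)

/-- **`a_n(pk′) = a_n(p)·a_{np}(k′)`** for a prime `p`, every `n` and every `k′` (`a_n = copTauW n`). [folklore] -/
theorem copTauW_prime_mul {p : ℕ} (hp : p.Prime) (n k : ℕ) :
    copTauW n (p * k) = copTauW n p * copTauW (n * p) k := by
  rcases eq_or_ne k 0 with rfl | hk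
  · simp
  by_cases hpk : p ∣ k
  · -- both sides vanish: `p² ∣ pk`, and `(k, np) ≠ 1`
    have hns : ¬ Squarefree (p * k) := by
      intro h
      obtain ⟨k', rfl⟩ := hpk
      have := h p ⟨k', by ring⟩
      exact hp.not_isUnit this
    have hl : copTauW n (p * k) = 0 := by
      rw [copTauW_apply]
      split_ifs
      · rw [W_eq_zero_of_not_squarefree hns, mul_zero]
      · rfl
    have hr : copTauW (n * p) k = 0 := by
      rw [copTauW_apply, if_neg]
      intro hcop
      have : Nat.Coprime k p := hcop.coprime_dvd_right (dvd_mul_left p n)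
      exact hp.ne_one ((Nat.coprime_comm.1 this).eq_one_of_dvd hpk)
    rw [hl, hr, mul_zero]
  · -- `p ∤ k`: multiplicativity, and `(k, np) = 1 ↔ (k, n) = 1`
    have hcop : Nat.Coprime p k := (Nat.Prime.coprime_iff_not_dvd hp).2 hpk
    rw [isMultiplicative_copTauW n |>.map_mul_of_coprime hcop]
    congr 1
    rw [copTauW_apply, copTauW_apply]
    have hiff : k.Coprime (n * p) ↔ k.Coprime n := by
      constructor
      · exact fun h ↦ h.coprime_dvd_right (dvd_mul_right n p)
      · exact fun h ↦ Nat.Coprime.mul_right h hcop.symm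
    simp only [hiff]

/-- **Removing an additive prime decoration from a Selberg-coordinate sum**: for every `n, N`, weight `G` and prime
weight `g`, `Σ_{k≤N} a_n(k)·G(k)·Σ_{p∣k} g(p) = Σ_{p ≤ N prime} g(p)·a_n(p)·Σ_{k′≤N/p} a_{np}(k′)·G(pk′)`
(`a_n(p) = −2/(p+1)` for `p ∤ n`, `0` for `p ∣ n`, `copTauW_apply_prime`).
[cite: KowalskiMichelVanderKam2000, (23)–(28) — derivation (prime decorations → prime sums)] -/
theorem sum_copTauW_mul_mul_sum_primeFactors_eq (n N : ℕ) (G g : ℕ → ℝ) :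
    ∑ k ∈ Icc 1 N, copTauW n k * G k * ∑ p ∈ k.primeFactors, g p =
      ∑ p ∈ (Icc 1 N).filter Nat.Prime, g p * copTauW n p *
        ∑ k ∈ Icc 1 (N / p), copTauW (n * p) k * G (p * k) := by
  rw [sum_mul_sum_primeFactors_eq N (fun k ↦ copTauW n k * G k) g]
  refine Finset.sum_congr rfl fun p hp ↦ ?_
  have hp' : p.Prime := (Finset.mem_filter.1 hp).2
  rw [Finset.mul_sum, mul_assoc, Finset.mul_sum, Finset.mul_sum]
  refine Finset.sum_congr rfl fun k _ ↦ ?_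
  rw [copTauW_prime_mul hp' n k]
  ring

end Summit.Parity.GeneralizedHardyLittlewood.Theorems.MomentsBeyondDiagonal.DiagLines

end
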